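import Literature.Topology.FourManifolds.SuspendedFamilyFoldChart
import Literature.Topology.FourManifolds.IndefiniteFoldModel
import HarnessLib

/-!
# From model fold charts to the `fold` clause on a manifold; the fold model itself

Topic `Literature/Topology/FourManifolds`.  Constructions of broken Lefschetz fibrations
(Baykur–Saeki 2017, Thm. 6.1; Lekili 2009, §3) are carried out in local coordinates: one
computes with a model map `F : ℝ⁴ → ℝ²` representing `f : X → B` in smooth charts `Φ₀` of the
4-manifold and `Ψ₀` of the surface, `F = Ψ₀ ∘ f ∘ Φ₀⁻¹`.  This file PROVES the bookkeeping
step that turns an indefinite fold chart of the MODEL (`HasIndefiniteFoldChart F (Φ₀ p)`,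
`SuspendedFamilyFoldChart.lean`) into the data demanded of `f` at `p` by the clause
`IsSimplifiedBrokenLefschetzFibration.fold` (charts `φ = φ_model ∘ Φ₀`, `ψ = ψ_model ∘ Ψ₀`), and
records that every critical point of the fold model `(t, x₁² + x₂² - x₃²)` has such a chart
(it is the suspended family of `g = x²`, `∂ₓ∂ₓ g = 2`).  No named fact is introduced.

* `exists_foldChart_of_hasIndefiniteFoldChart` — **model fold chart ⇒ `fold`-clause charts
  for `f`**;
* `indefiniteFoldMap_eq_suspendedMap`, `hasIndefiniteFoldChart_indefiniteFoldMap` — the fold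
  model at each of its critical points.

## References

* R. İ. Baykur, O. Saeki, *Simplifying indefinite fibrations on 4-manifolds*, arXiv:1705.11169
  (Trans. AMS 376, 2023), §2.1. [BaykurSaeki2017]
* K. Hayano, *On genus-1 simplified broken Lefschetz fibrations*, Algebr. Geom. Topol. 11
  (2011), Def. 2.1 (4). [Hayano2011]
-/

noncomputable section

open Set Function Filter
open scoped Manifold Topology ContDiff

namespace Literature.Topology.FourManifolds

/-! ### Model fold chart ⇒ the `fold` clause -/

section Transport

variable {X : Type*} [TopologicalSpace X] [ChartedSpace (EuclideanSpace ℝ (Fin 4)) X]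
  {B : Type*} [TopologicalSpace B] [ChartedSpace (EuclideanSpace ℝ (Fin 2)) B]

/-- **From a fold chart of the local model to the `fold` clause.**  Let `Φ₀` be a smooth chart
of `X` (valued in `ℝ⁴`, smooth with smooth inverse) at `p`, `Ψ₀` a smooth chart of the surface
`B` (valued in `ℝ²`) with `f (Φ₀.source) ⊆ Ψ₀.source`, and suppose the local representative
`F = Ψ₀ ∘ f ∘ Φ₀⁻¹ : ℝ⁴ → ℝ²` has an indefinite fold chart at `Φ₀ p`
(`HasIndefiniteFoldChart`, e.g. by `hasIndefiniteFoldChart_suspendedMap`).  Then `f` has, at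
`p`, charts `φ` (centred) and `ψ` as in `IsSimplifiedBrokenLefschetzFibration.fold`:
`ψ (f q) = ((φ q)₀, (φ q)₁² + (φ q)₂² - (φ q)₃²)` on `φ.source` — namely
`φ = φ_model ∘ Φ₀`, `ψ = ψ_model ∘ Ψ₀`. [cite: BaykurSaeki2017, §2.1] -/
theorem exists_foldChart_of_hasIndefiniteFoldChart {f : X → B}
    {Φ₀ : OpenPartialHomeomorph X (EuclideanSpace ℝ (Fin 4))}
    {Ψ₀ : OpenPartialHomeomorph B (EuclideanSpace ℝ (Fin 2))}
    (hΦ₀ : ContMDiffOn (𝓡 4) (𝓡 4) ∞ Φ₀ Φ₀.source)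
    (hΦ₀s : ContMDiffOn (𝓡 4) (𝓡 4) ∞ Φ₀.symm Φ₀.target)
    (hΨ₀ : ContMDiffOn (𝓡 2) (𝓡 2) ∞ Ψ₀ Ψ₀.source)
    (hΨ₀s : ContMDiffOn (𝓡 2) (𝓡 2) ∞ Ψ₀.symm Ψ₀.target)
    (hmaps : MapsTo f Φ₀.source Ψ₀.source) {p : X} (hp : p ∈ Φ₀.source)
    (hF : HasIndefiniteFoldChart (Ψ₀ ∘ f ∘ Φ₀.symm) (Φ₀ p)) :
    ∃ (φ : OpenPartialHomeomorph X (EuclideanSpace ℝ (Fin 4)))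
      (ψ : OpenPartialHomeomorph B (EuclideanSpace ℝ (Fin 2))),
      p ∈ φ.source ∧ φ p = 0 ∧ MapsTo f φ.source ψ.source ∧
      ContMDiffOn (𝓡 4) (𝓡 4) ∞ φ φ.source ∧ ContMDiffOn (𝓡 4) (𝓡 4) ∞ φ.symm φ.target ∧
      ContMDiffOn (𝓡 2) (𝓡 2) ∞ ψ ψ.source ∧ ContMDiffOn (𝓡 2) (𝓡 2) ∞ ψ.symm ψ.target ∧
      ∀ q ∈ φ.source, (ψ (f q)) 0 = (φ q) 0 ∧
        (ψ (f q)) 1 = (φ q) 1 ^ 2 + (φ q) 2 ^ 2 - (φ q) 3 ^ 2 := by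
  obtain ⟨φm, ψm, hpm, hpm0, hmapsm, hφm, hφms, hψm, hψms, hid⟩ := hF
  -- smoothness of the model charts in manifold language
  have hφm' : ContMDiffOn (𝓡 4) (𝓡 4) ∞ φm φm.source := contMDiffOn_iff_contDiffOn.2 hφm
  have hφms' : ContMDiffOn (𝓡 4) (𝓡 4) ∞ φm.symm φm.target := contMDiffOn_iff_contDiffOn.2 hφms
  have hψm' : ContMDiffOn (𝓡 2) (𝓡 2) ∞ ψm ψm.source := contMDiffOn_iff_contDiffOn.2 hψm
  have hψms' : ContMDiffOn (𝓡 2) (𝓡 2) ∞ ψm.symm ψm.target := contMDiffOn_iff_contDiffOn.2 hψms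
  -- the local representative at points of `Φ₀.source`
  have hFq : ∀ q ∈ Φ₀.source, (Ψ₀ ∘ f ∘ Φ₀.symm) (Φ₀ q) = Ψ₀ (f q) := fun q hq => by
    simp only [Function.comp_apply, Φ₀.left_inv hq]
  refine ⟨Φ₀.trans φm, Ψ₀.trans ψm, ?_, ?_, ?_, ?_, ?_, ?_, ?_, ?_⟩
  · rw [OpenPartialHomeomorph.trans_source]
    exact ⟨hp, hpm⟩
  · rw [OpenPartialHomeomorph.coe_trans, Function.comp_apply, hpm0]
  · intro q hq
    rw [OpenPartialHomeomorph.trans_source] at hq ⊢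
    refine ⟨hmaps hq.1, ?_⟩
    show Ψ₀ (f q) ∈ ψm.source
    rw [← hFq q hq.1]
    exact hmapsm hq.2
  · rw [OpenPartialHomeomorph.trans_source, OpenPartialHomeomorph.coe_trans]
    exact hφm'.comp (hΦ₀.mono inter_subset_left) fun q hq => hq.2
  · rw [OpenPartialHomeomorph.trans_symm_eq_symm_trans_symm, OpenPartialHomeomorph.trans_target,
      OpenPartialHomeomorph.coe_trans]
    exact hΦ₀s.comp (hφms'.mono inter_subset_left) fun y hy => hy.2
  · rw [OpenPartialHomeomorph.trans_source, OpenPartialHomeomorph.coe_trans]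
    exact hψm'.comp (hΨ₀.mono inter_subset_left) fun q hq => hq.2
  · rw [OpenPartialHomeomorph.trans_symm_eq_symm_trans_symm, OpenPartialHomeomorph.trans_target,
      OpenPartialHomeomorph.coe_trans]
    exact hΨ₀s.comp (hψms'.mono inter_subset_left) fun y hy => hy.2
  · intro q hq
    rw [OpenPartialHomeomorph.trans_source] at hq
    simp only [OpenPartialHomeomorph.coe_trans, Function.comp_apply]
    have h := hid (Φ₀ q) hq.2
    rw [hFq q hq.1] at h
    exact h

end Transport

/-! ### The fold model at its critical points -/

/-- The fold model IS the suspended family of `g(t, x) = x²`. [folklore] -/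
theorem indefiniteFoldMap_eq_suspendedMap : indefiniteFoldMap = suspendedMap fun p => p.2 ^ 2 := by
  funext x
  ext i
  fin_cases i <;> simp [indefiniteFoldMap, suspendedMap]

/-- **Every critical point of the fold model has an indefinite fold chart** (centred at the
point): `g = x²` has `∂ₓ g = 2x = 0` exactly on the `t`-axis and `∂ₓ∂ₓ g = 2 ≠ 0`, so
`hasIndefiniteFoldChart_suspendedMap` applies at every point of the critical set
`{x₁ = x₂ = x₃ = 0}` (`surjective_fderiv_indefiniteFoldMap_iff`). [folklore] -/
theorem hasIndefiniteFoldChart_indefiniteFoldMap {x : EuclideanSpace ℝ (Fin 4)}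
    (hx : ¬ Surjective (fderiv ℝ indefiniteFoldMap x)) :
    HasIndefiniteFoldChart indefiniteFoldMap x := by
  rw [surjective_fderiv_indefiniteFoldMap_iff, not_not] at hx
  obtain ⟨h1, h2, h3⟩ := hx
  have e1 : ∀ p : ℝ × ℝ, fderiv ℝ (fun p : ℝ × ℝ => p.2 ^ 2) p (0, 1) = 2 * p.2 := fun p => by
    obtain ⟨g', hg, hval⟩ : ∃ g' : ℝ × ℝ →L[ℝ] ℝ,
        HasFDerivAt (fun p : ℝ × ℝ => p.2 ^ 2) g' p ∧ g' (0, 1) = 2 * p.2 :=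
      ⟨_, hasFDerivAt_snd.pow 2, by simp⟩
    rw [hg.fderiv, hval]
  rw [indefiniteFoldMap_eq_suspendedMap]
  refine hasIndefiniteFoldChart_suspendedMap (contDiff_snd.pow 2) ?_ ?_ h2 h3
  · rw [e1]
    simp [h1]
  · rw [show (fun p : ℝ × ℝ => fderiv ℝ (fun p : ℝ × ℝ => p.2 ^ 2) p (0, 1)) = fun p => 2 * p.2
        from funext e1]
    obtain ⟨g'', hg2, hval2⟩ : ∃ g'' : ℝ × ℝ →L[ℝ] ℝ,
        HasFDerivAt (fun p : ℝ × ℝ => 2 * p.2) g'' (x 0, x 1) ∧ g'' (0, 1) = 2 :=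
      ⟨_, hasFDerivAt_snd.const_mul 2, by simp⟩
    rw [hg2.fderiv, hval2]
    norm_num

end Literature.Topology.FourManifolds

end
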